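import Literature.MathematicalPhysics.QuantumFieldTheory.Balaban1983to89.B2Ineq329CovariantAveraging
import Literature.MathematicalPhysics.QuantumFieldTheory.Balaban1983to89.HiggsAveragingCompose

/-!
# `Balaban1983to89.B2Ineq329BlockPoincare` — [Balaban1982Higgs2] (3.29) p. 590 FOR A REGULAR NON-ZERO VECTOR FIELD `Ã`,
file 3/4: **the multilevel covariant block Poincaré inequality on `Bᵏ(Λ)`** on the CONCRETE torus carrier — for
`Λ ⊂ T⁽ᵏ⁾_{Lᵏε}`, `Ω = Bᵏ(Λ) ⊂ T_ε` (`k ≤ K`), any `v : T_ε → ℝ^N` and `Ã` with one-step differences `≤ δ` on `Ω` ((1.21) of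
[B4] in lattice units),
`Σ_{x∈Ω} ε^d|v(x)|² ≤ Σ_{y∈Λ}(Lᵏε)^d|(Q_k(Ã)v)(y)|² + 4dL^d(Lᵏε)² Σ_{b⊂Ω} ε^d|(D^ε_Ã v)(b)|² + 8d⁴L^d e²(Lᵏε)²(Lᵏδ)² Σ_{x∈Ω} ε^d|v(x)|²`
— the field on the blocks is controlled by its covariant block averages (I.2.11), its covariant Dirichlet energy times the
block size squared, and a holonomy error.  This is the step of the proof of «Proposition 3.1′ of [2]» = (3.29) that converts
the mass term `m² Σ_{x∈Ω} ε^d|φ(x)|²` of the (I.2.19) exponent into a bound in terms of the block variables, so that the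
holonomy error of the covariant averaging inequality (file 2) takes the printed form `−O(1)e²p²(e) Σ_{x∈Ω⁽ᵏ⁾}|φ(x)|²` of (1.22)
(file 4).  Mechanism (one level at a time, hub = the block corner): `Σ_{x∈B(z)}|W_j(x)|² = L^d|W_{j+1}(z)|² + variance`,
`variance ≤ Σ_x |U(Ã(Γ_{z,x}))W_j(x) − W_j(z)|²`, telescoped through the `≤ d(L−1)` level-`j` bonds of the staircase
`Γ_{z,x}` with the coarse transports `U(Lʲε Ā⁽ʲ⁾) = U(ε Σ_{straight} Ã)` ((II.2.55)), Cauchy–Schwarz, multiplicity `≤ L^d`,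
and the level-`j` energy of `W_j = Q_j(Ã)v` bounded by file 2's `cov_averaging_ineq` AT LEVEL `j`; summed over `j < k`.

statement-level skeleton of published theorems with citation tags; proofs where landed; nothing here is a claim about the Yang–Mills mass gap

CITATION HEADER.  T. Bałaban, *(Higgs)₂,₃ quantum fields in a finite volume. II. An upper bound*, Commun. Math. Phys.
**86** (1982) 555–594 [Balaban1982Higgs2] (cell paper B2; PDF held `paper:balaban1982-cmp86-higgs23-ii`, journal page
= PDF page + 554; p. 589–590 [PDF 35–36] READ AS IMAGES on the ×2 renders
`run/shared/lean/pub/pub-balaban/b2b-balaban-ref1/pages/1982-cmp86-higgs23-II/1982-cmp86-higgs23-II-p035-x2.png`, `-p036-x2.png`);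
T. Bałaban, *Regularity and decay of lattice Green's functions*, Commun. Math. Phys. **89** (1983) 571–597
[Balaban1983RegularityDecay] (= [B4]; `paper:balaban1983-cmp89-regularity-decay`, journal page = PDF page + 570; p. 574
[PDF 4] and §4 pp. 589–591 [PDF 19–21] read on the ×2 renders `…/1983-cmp89-regularity-decay/…-p004/p019/p020-x2.png`);
part I [Balaban1982Higgs1], Commun. Math. Phys. **85** (1982) 603–626, (1.17)–(1.20) pp. 606–607, (2.1)–(2.3), (2.7) p. 608,
(2.11) p. 609; part II (2.16) p. 559, (2.55) p. 570.
Cell `lit-balaban` (HOME `run/shared/lean/pub/lit-balaban/`), Phase-2 proof seat **p23** gen 9 (unit `lit-balaban-p23-g9`);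
SKELETON rows **B2.Eq3.29** / **B2.Prop3.1** (owner r02, second reader r14, referee ref-4), their last residue = cell
GAPS G-pv07-1: (3.29) for a RESTRICTED (regular, non-zero) `Ã`.  Files 1–2 (`B2Ineq329PrismHolonomy`,
`B2Ineq329CovariantAveraging`) landed; file 4 (`B2Ineq329RegularField`) carries (3.29) itself and the Prop. 3.1 restricted
clause.  REUSED BY NAME, never restated: the typer's `HiggsAveraging.{avgQk, avgQ, avgQ_apply, blockIter, blockK, toFinest,
shiftN, segSum, contourSum}`, `HiggsAveragingCompose.avgQ_avgQk` (`Q Q_j = Q_{j+1}`), `HiggsLattice.{block, blockOf, covDeriv}`,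
p17's `B2Restr216Lattice.{cornerN, contourSum_split, update_cornerN_succ, card_block, mem_block_iff, norm_U_apply}`, p33's
`B2Eq255Concrete.barA`, p15's `B2Ineq329ZeroAveraging.{val_blockIter, blockIter_shiftN_pow, shiftN_*, mesh_eq}`, file 1's
`B2Ineq329PrismHolonomy.{val_toFinest, val_toFinest_blockIter, toFinest_blockIter_shiftN, shiftN_cornerN_succ}`, file 2's
`B2Ineq329CovariantAveraging.{U_mesh_barA, cov_averaging_ineq}`.

WHAT IS PRINTED.  [B2] p. 590 [PDF 36], verbatim: *"Now inequality (3.26) of the proposition follows from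
⟨φ′_k, Δ⁽ᵏ⁾(Bᵏ(Λ_k), Ã^η)φ′_k⟩ ≥ γ₀(Σ_{⟨x,x′⟩⊂Λ_k} |U(Ã^η(⟨x,x′⟩))φ′_k(x′) − φ′_k(x)|² + Σ_{x∈Λ_k} m²(Lᵏε)²|φ′_k(x)|²)
− O((Lᵏε)^{κ₀})|Λ_k|, (3.29) with a constant γ₀ independent of k, Λ_k and for φ′_k, Ã^η satisfying suitable restrictions.
This inequality will be proved together with the properties of the covariances (formulated in Propositions I.2.1 and
I.2.3)."*  [B4] p. 574 [PDF 4], verbatim: *"Proposition 3.1′ of [2]. Let Ω be a sum of unit blocks (i.e. Ω⁽ᵏ⁾ is an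
arbitrary subset of Zᵈ) and let A satisfies the condition |(∂^η_μA)(x)| ≤ O(1)p(e) (p(e) = a₀(1 + log e⁻¹)ᵖ), (1.21) then
there exists a positive constant γ₀ depending on d only, such that for e sufficiently small ⟨φ, Δ⁽ᵏ⁾(Ω,A)φ⟩ ≥
γ₀(Σ_{⟨x,x′⟩⊂Ω⁽ᵏ⁾}|U(A(⟨x,x′⟩))φ(x′) − φ(x)|² + m²Σ_{x∈Ω⁽ᵏ⁾}|φ(x)|²) − O(1)e^{2−α}Σ_{x∈Ω⁽ᵏ⁾}|φ(x)|² (1.22) … This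
theorem implies (3.29) of [2]."*  [B4] p. 590 [PDF 20], verbatim: *"Using the regularity condition for A, we write A = A₀ + A′
on Δ(x,x′) with A₀ constant and A′ satisfying the bounds |A′|, |∂^η_μA′| ≤ O(1)p(e). We expand the expression on the left
hand side of (4.7) with respect to A′ using (I.3.15), (I.3.44), and we separate terms of first order in e. Using Lemma 2.1
the remaining terms can be easily estimated by O(e²p²(e))(|φ(x)|² + |φ(x′)|²)."*  [B1] p. 608–609: *"(Q(A)φ)(y) =
L^{−d}Σ_{x∈B(y)} U(A(Γ_{y,x}))φ(x) (2.7)"*, *"Γ^{(k)}_{y,x} = Γ_{y,x_{k−1}} ∪ … ∪ Γ_{x₁,x} (2.2)"*, *"(Q_k(A)f)(y) =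
L^{−kd}Σ_{x∈Bᵏ(y)} U(A(Γ^{(k)}_{y,x}))f(x) (2.11)"*.

DICTIONARY (print ↦ Lean; everything on the typer's concrete tori `Site P j`, levels `≤ K`).  «A regular» (1.21) ↦
`|Ã ⟨z + εe_ν, μ′⟩ − Ã ⟨z, μ′⟩| ≤ δ` at the sites `z ∈ Ω`; `Q_j(Ã)v` ↦ `avgQk C Ã j v` (`W_j`); `Q(Ã)W_j = W_{j+1}` ↦
`HiggsAveragingCompose.avgQ_avgQk`; `U(Ã(Γ_{z,x}))` ↦ `C.U (P.mesh 0) (contourSum Ã (toFinest z) (toFinest x))`; the coarse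
transport `U(Lʲε·Ā⁽ʲ⁾(c))` ↦ `C.U (P.mesh j) (barA j Ã c)` (= `U(ε, Σ_{straight}Ã)`, `U_mesh_barA`); the level sets of
`Ω = Bᵏ(Λ)` ↦ `Ω_j = {q ∈ T⁽ʲ⁾ : (q̃)_k ∈ Λ}` written `Finset.univ.filter (fun q => blockIter k (toFinest q) ∈ Λ)` (`Ω_0 = Ω`,
`Ω_k = Λ`, `Ω_j = ⋃_{z∈Ω_{j+1}} B(z)`); the printed error `O(1)e^{2−α}Σ_{Ω⁽ᵏ⁾}|φ|²` is reached in file 4 from this file's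
`8d⁴L^d e²(Lᵏε)²(Lᵏδ)²`-term — the print never isolates a Poincaré step (it works with the Green's functions `G_k(Δ(x,x′),A)`
of (4.5)–(4.9)); this inequality is the lineage's replacement on the torus, where those Green's-function estimates are not
in the tree.

WHAT THIS MODULE PROVES (kernel-checked, 0 `sorry`, standard axioms; theorems only, no new definition, no `Prop` fact).
 §1 labels: `blockIter_toFinest` (`(q̃)_j = q`), `blockIter_toFinest_blockIter` (`(x̃_j)_k = x_k`), `blockIter_toFinest_eq_blockOf`.
 §2 `sum_norm_sq_le_mean_add_var` (mean and variance), `avgQk_level_zero` (`Q_0 = 1`), `mesh_succ_pow_d`,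
    **`level_step_block`**: `Σ_{x∈B(z)}(Lʲε)^d|W_j(x)|² ≤ (Lʲ⁺¹ε)^d|W_{j+1}(z)|² + (Lʲε)^d Σ_{x∈B(z)}|U(Ã(Γ_{z,x}))W_j(x) − h|²`.
 §3 `norm_U_sum_sub_le` (covariant telescoping along any bond path), `segSum_mul_len`, `toFinest_blockIter_cornerN`,
    `val_toFinest_sub` (steps = `x_ν mod L`), **`norm_transport_sub_hub_le`** (the hub bound by the level-`j` covariant
    derivatives along the staircase).
 §4 `val_toFinest_le`, `blockIter_succ_eq_of_window`, `toFinest_blockIter_stair`, `blockIter_stair_shift`, `stair_window`,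
    `blockIter_stair_mem_block`, `blockIter_stair_inj`, `norm_transport_sub_hub_sq_le` (Cauchy–Schwarz), `sum_stair_le`
    (multiplicity `≤ L^d`), **`var_block_le`**.
 §5 `sum_level_succ` (`Ω_j = ⋃ B(z)`), `sum_blocks_le_inside`, **`level_step`**, `energy_level_le` (file 2 at level `j`),
    (private `geom_level_sum_le`), `multilevel_le`, **`block_poincare`** (the display in the title).
HONEST SCOPE.  (i) An auxiliary inequality of the lineage's route, not a display of [B2]/[B4]; its role in (3.29) is file 4's.
(ii) Constants `4dL^d`, `8d⁴L^d` are ours and not optimised (the geometric sums over the levels are bounded by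
`(L−1)Σ_{j<k}qʲ ≤ qᵏ`).  (iii) Levels `k ≤ K`; the hub is the image of the block corner, any other hub would do.
-/

open scoped BigOperators

namespace Literature.MathematicalPhysics.QuantumFieldTheory.Balaban1983to89.B2Ineq329BlockPoincare

open Finset
open Literature.MathematicalPhysics.QuantumFieldTheory.Balaban1983to89.HiggsLattice
open Literature.MathematicalPhysics.QuantumFieldTheory.Balaban1983to89.HiggsAveraging
open Literature.MathematicalPhysics.QuantumFieldTheory.Balaban1983to89.B2Ineq329ZeroAveraging
open Literature.MathematicalPhysics.QuantumFieldTheory.Balaban1983to89.HiggsCovariancePos (Inside)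
open Literature.MathematicalPhysics.QuantumFieldTheory.Balaban1983to89.B2Restr216Lattice (cornerN cornerN_zero cornerN_d
  segSum_succ shiftN_succ toFinest_zero norm_U_apply card_block val_blockOf mem_block_iff contourSum_self contourSum_split
  update_cornerN_succ)
open Literature.MathematicalPhysics.QuantumFieldTheory.Balaban1983to89.B2Eq255Concrete (barA barA_apply)
open Literature.MathematicalPhysics.QuantumFieldTheory.Balaban1983to89.B1Eq353SupNorm (card_blockK)
open Literature.MathematicalPhysics.QuantumFieldTheory.Balaban1983to89.HiggsAveragingCompose (avgQ_avgQk blockIter_succ)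
open Literature.MathematicalPhysics.QuantumFieldTheory.Balaban1983to89.B2Ineq329PrismHolonomy
open Literature.MathematicalPhysics.QuantumFieldTheory.Balaban1983to89.B2Ineq329CovariantAveraging

variable {P : Params} {N : ℕ}

/-! ## §1 Labels: `(x̃_j)_k = x_k`, `(q̃)_j = q`, and the level sets `Ω_j = Bʲ-block points of Ω` -/

section Labels

/-- The `j`-block point of the `T_ε`-image of a level-`j` site is the site itself (`j ≤ K`). [cite: Balaban1982Higgs1, (1.20) p.607] -/
theorem blockIter_toFinest {j : ℕ} (hj : j ≤ P.K) (q : Site P j) : blockIter j (toFinest q) = q := by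
  funext ν
  apply ZMod.val_injective
  rw [val_blockIter hj, val_toFinest hj, Nat.mul_div_cancel _ (pow_pos P.hL j)]

/-- The `k`-block point of the `T_ε`-image of the `j`-block point of `x` is the `k`-block point of `x` (`j ≤ k ≤ K`):
`⌊Lʲ⌊x/Lʲ⌋/Lᵏ⌋ = ⌊x/Lᵏ⌋`. [cite: Balaban1982Higgs1, (2.2) p.608] -/
theorem blockIter_toFinest_blockIter {j k : ℕ} (hjk : j ≤ k) (hk : k ≤ P.K) (x : Site P 0) :
    blockIter k (toFinest (blockIter j x)) = blockIter k x := by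
  funext ν
  apply ZMod.val_injective
  rw [val_blockIter hk, val_blockIter hk, val_toFinest_blockIter (hjk.trans hk)]
  obtain ⟨i, rfl⟩ := Nat.exists_eq_add_of_le hjk
  rw [pow_add, ← Nat.div_div_eq_div_mul, ← Nat.div_div_eq_div_mul, Nat.mul_div_cancel _ (pow_pos P.hL j)]

/-- For a level-`j` site `q` (`j + 1 ≤ k ≤ K`): the `k`-block point of `q̃` is that of the image of its block point
(`Bʲ⁺¹(z) = ⋃_{q∈B(z)} Bʲ(q)`). [cite: Balaban1982Higgs1, (1.20) p.607] -/
theorem blockIter_toFinest_eq_blockOf {j k : ℕ} (hjk : j + 1 ≤ k) (hk : k ≤ P.K) (q : Site P j) :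
    blockIter k (toFinest q) = blockIter k (toFinest (blockOf q)) := by
  have h := blockIter_toFinest_blockIter hjk hk (toFinest q)
  rw [blockIter_succ, blockIter_toFinest (by omega) q] at h
  exact h.symm

end Labels

/-! ## §2 One level: `Σ_{x∈B(z)}|W_j(x)|² = L^d|W_{j+1}(z)|² + (variance)` and the variance about any hub -/

section OneLevel

/-- **Mean and variance in a real inner product space**: for vectors `g_i`, `i ∈ s` (`|s| = n > 0`), and ANY `h`,
`Σ_i |g_i|² ≤ n·|n⁻¹Σ_i g_i|² + Σ_i |g_i − h|²` (equality at `h` = the mean; the difference is `n⁻¹|Σ_i g_i − n h|² ≥ 0`).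
[folklore] [cite: Balaban1983RegularityDecay, (1.22) p.574] -/
theorem sum_norm_sq_le_mean_add_var {ι : Type*} (s : Finset ι) (hs : 0 < s.card) (g : ι → EuclideanSpace ℝ (Fin N))
    (h : EuclideanSpace ℝ (Fin N)) :
    ∑ i ∈ s, ‖g i‖ ^ 2 ≤ (s.card : ℝ) * ‖((s.card : ℝ)⁻¹) • ∑ i ∈ s, g i‖ ^ 2 + ∑ i ∈ s, ‖g i - h‖ ^ 2 := by
  set n : ℝ := (s.card : ℝ) with hn
  have hn0 : 0 < n := by rw [hn]; exact_mod_cast hs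
  set S := ∑ i ∈ s, g i with hS
  have hexp : ∀ i, ‖g i - h‖ ^ 2 = ‖g i‖ ^ 2 - 2 * inner ℝ (g i) h + ‖h‖ ^ 2 := fun i => norm_sub_sq_real _ _
  have hsum : ∑ i ∈ s, ‖g i - h‖ ^ 2 = ∑ i ∈ s, ‖g i‖ ^ 2 - 2 * inner ℝ S h + n * ‖h‖ ^ 2 := by
    simp_rw [hexp]
    rw [Finset.sum_add_distrib, Finset.sum_sub_distrib, Finset.sum_const, nsmul_eq_mul, ← Finset.mul_sum,
      ← sum_inner]
  have hmean : n * ‖(n⁻¹) • S‖ ^ 2 = n⁻¹ * ‖S‖ ^ 2 := by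
    rw [norm_smul, mul_pow, Real.norm_eq_abs, abs_of_pos (inv_pos.2 hn0)]
    field_simp
  have hkey : 0 ≤ n⁻¹ * ‖S‖ ^ 2 - 2 * inner ℝ S h + n * ‖h‖ ^ 2 := by
    have e : n⁻¹ * ‖S‖ ^ 2 - 2 * inner ℝ S h + n * ‖h‖ ^ 2 = n⁻¹ * ‖S - n • h‖ ^ 2 := by
      rw [norm_sub_sq_real, inner_smul_right, norm_smul, mul_pow, Real.norm_eq_abs, abs_of_pos hn0]
      field_simp
    rw [e]
    exact mul_nonneg (inv_pos.2 hn0).le (sq_nonneg _)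
  rw [hmean, hsum]
  linarith

/-- **`Q_0(Ã) = 1`**: the order-zero average is the field itself (`B⁰(x) = {x}`, empty contour). [cite: Balaban1982Higgs1, (2.11) p.609] -/
theorem avgQk_level_zero (C : ChargeData N) (A : VecField P 0) (v : ScalarField P 0 N) : avgQk C A 0 v = v := by
  funext y
  rw [avgQk_apply]
  have hB : blockK (P := P) 0 y = {y} := by
    ext x; rw [mem_blockK, Finset.mem_singleton]; rfl
  rw [hB, Finset.sum_singleton, multiContourSum_zero, ChargeData.U_zero, zero_mul, pow_zero, inv_one, one_smul]
  rfl

variable {j : ℕ}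

/-- `(Lʲ⁺¹ε)^d = L^d·(Lʲε)^d`. [cite: Balaban1982Higgs1, (1.19) p.607] -/
theorem mesh_succ_pow_d (j : ℕ) : P.mesh (j + 1) ^ P.d = (P.L : ℝ) ^ P.d * P.mesh j ^ P.d := by
  rw [mesh_eq (j + 1), mesh_eq j, pow_succ, mul_pow, mul_pow, mul_pow]
  ring

/-- **One level of the block Poincaré inequality**, for a block `B(z)`, `z ∈ T⁽ʲ⁺¹⁾` (`j < K`), `W_j = Q_j(Ã)v`,
`W_{j+1} = Q(Ã)W_j = Q_{j+1}(Ã)v` ((I.2.11): `Q_{j+1} = Q Q_j`) and ANY hub vector `h`: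
`Σ_{x∈B(z)} (Lʲε)^d|W_j(x)|² ≤ (Lʲ⁺¹ε)^d|W_{j+1}(z)|² + (Lʲε)^d Σ_{x∈B(z)} |U(Ã(Γ_{z,x}))W_j(x) − h|²` (the transports are
unitary, `|B(z)| = L^d`, mean-and-variance). [cite: Balaban1982Higgs1, (2.7), (2.11) pp.608–609] [cite: Balaban1983RegularityDecay, (1.22) p.574] -/
theorem level_step_block (hj : j < P.K) (C : ChargeData N) (A : VecField P 0) (v : ScalarField P 0 N)
    (z : Site P (j + 1)) (h : EuclideanSpace ℝ (Fin N)) :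
    ∑ x ∈ block z, P.mesh j ^ P.d * ‖avgQk C A j v x‖ ^ 2
      ≤ P.mesh (j + 1) ^ P.d * ‖avgQk C A (j + 1) v z‖ ^ 2
        + P.mesh j ^ P.d * ∑ x ∈ block z,
            ‖C.U (P.mesh 0) (contourSum A (toFinest z) (toFinest x)) (avgQk C A j v x) - h‖ ^ 2 := by
  set W := avgQk C A j v with hW
  set g : Site P j → EuclideanSpace ℝ (Fin N) :=
    fun x => C.U (P.mesh 0) (contourSum A (toFinest z) (toFinest x)) (W x) with hg
  have hcard : (block z).card = P.L ^ P.d := card_block hj z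
  have hcardR : ((block z).card : ℝ) = (P.L : ℝ) ^ P.d := by rw [hcard]; push_cast; rfl
  have hpos : 0 < (block z).card := by rw [hcard]; exact pow_pos P.hL _
  have hmv := sum_norm_sq_le_mean_add_var (block z) hpos g h
  have hnorm : ∀ x, ‖g x‖ = ‖W x‖ := fun x => norm_U_apply C _ _ _
  simp_rw [hnorm] at hmv
  have havg : avgQk C A (j + 1) v z = (((block z).card : ℝ)⁻¹) • ∑ x ∈ block z, g x := by
    rw [← avgQ_avgQk, avgQ_apply, hcardR]
  rw [havg, mesh_succ_pow_d, ← Finset.mul_sum, hcardR]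
  have hm : 0 ≤ P.mesh j ^ P.d := pow_nonneg (P.mesh_pos j).le _
  calc P.mesh j ^ P.d * ∑ x ∈ block z, ‖W x‖ ^ 2
      ≤ P.mesh j ^ P.d * (((P.L : ℝ) ^ P.d) * ‖(((P.L : ℝ) ^ P.d)⁻¹) • ∑ x ∈ block z, g x‖ ^ 2
          + ∑ x ∈ block z, ‖g x - h‖ ^ 2) := by
        rw [← hcardR]; exact mul_le_mul_of_nonneg_left hmv hm
    _ = (P.L : ℝ) ^ P.d * P.mesh j ^ P.d * ‖(((P.L : ℝ) ^ P.d)⁻¹) • ∑ x ∈ block z, g x‖ ^ 2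
          + P.mesh j ^ P.d * ∑ x ∈ block z, ‖g x - h‖ ^ 2 := by ring

end OneLevel

/-! ## §3 The hub bound: covariant telescoping of `W_j` from the block corner along the staircase `Γ_{z,x}` at level `j` -/

section Hub

variable {j : ℕ}

/-- **Covariant telescoping along any bond path** (abelian transports): `|U(Σ_{m<T} a_m) w_T − w_0| ≤ Σ_{m<T}
|U(a_m) w_{m+1} − w_m|` (unitarity and `U(a)U(b) = U(a+b)`, p. 605). [cite: Balaban1982Higgs1, (1.7) p.605]
[cite: Balaban1982Higgs2, (2.16) p.559] -/
theorem norm_U_sum_sub_le (C : ChargeData N) (η : ℝ) (a : ℕ → ℝ) (w : ℕ → EuclideanSpace ℝ (Fin N)) :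
    ∀ T : ℕ, ‖C.U η (∑ m ∈ Finset.range T, a m) (w T) - w 0‖
      ≤ ∑ m ∈ Finset.range T, ‖C.U η (a m) (w (m + 1)) - w m‖ := by
  intro T
  induction T with
  | zero => simp [ChargeData.U_zero]
  | succ T ih =>
    rw [Finset.sum_range_succ, Finset.sum_range_succ, ChargeData.U_add, mul_apply_eq_comp]
    have key : C.U η (∑ m ∈ Finset.range T, a m) (C.U η (a T) (w (T + 1))) - w 0
        = C.U η (∑ m ∈ Finset.range T, a m) (C.U η (a T) (w (T + 1)) - w T)
          + (C.U η (∑ m ∈ Finset.range T, a m) (w T) - w 0) := by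
      rw [map_sub]; abel
    rw [key]
    refine (norm_add_le _ _).trans ?_
    rw [norm_U_apply, add_comm]
    exact add_le_add ih le_rfl

/-- Splitting a straight segment of `n·T` bonds into `T` consecutive segments of `n` bonds ((I.2.3) is additive under
concatenation). [cite: Balaban1982Higgs1, (2.3) p.608] -/
theorem segSum_mul_len (A : VecField P 0) (u : Site P 0) (μ : Fin P.d) (n : ℕ) :
    ∀ T : ℕ, segSum A u μ (n * T) = ∑ m ∈ Finset.range T, segSum A (shiftN u μ (n * m)) μ n := by
  intro T
  induction T with
  | zero => simp [segSum]
  | succ T ih =>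
    rw [Finset.sum_range_succ, ← ih, Nat.mul_succ]
    unfold segSum
    rw [Finset.sum_range_add]
    congr 1
    refine Finset.sum_congr rfl fun i _ => ?_
    rw [shiftN_add]

/-- The corners of the staircase between the images `z̃`, `x̃` of `z ∈ T⁽ʲ⁺¹⁾` and `x ∈ T⁽ʲ⁾` are images of level-`j` sites
(their labels are multiples of `Lʲ`; `j < K`). [cite: Balaban1982Higgs1, (2.1) p.608] -/
theorem toFinest_blockIter_cornerN (hj : j < P.K) (z : Site P (j + 1)) (x : Site P j) (s : ℕ) :
    toFinest (blockIter j (cornerN (toFinest z) (toFinest x) s)) = cornerN (toFinest z) (toFinest x) s := by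
  have hLj : 0 < P.L ^ j := pow_pos P.hL j
  funext ν
  apply ZMod.val_injective
  rw [val_toFinest_blockIter hj.le]
  simp only [cornerN]
  split_ifs
  · rw [val_toFinest hj z, pow_succ, show (z ν).val * (P.L ^ j * P.L) = (z ν).val * P.L * P.L ^ j by ring,
      Nat.mul_div_cancel _ hLj]
  · rw [val_toFinest hj.le x, Nat.mul_div_cancel _ hLj]

/-- **The number of level-`j` steps of `Γ_{z,x}` in direction `ν`** is the offset `x_ν mod L ∈ {0,…,L−1}` of `x` in its
block: `x̃_ν − z̃_ν = Lʲ·(x_ν mod L)` (`x ∈ B(z)`, `j < K`). [cite: Balaban1982Higgs1, (1.17) p.606, (2.1) p.608] -/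
theorem val_toFinest_sub (hj : j < P.K) {z : Site P (j + 1)} {x : Site P j} (hx : x ∈ block z) (ν : Fin P.d) :
    ((toFinest x) ν - (toFinest z) ν).val = P.L ^ j * ((x ν).val % P.L) := by
  rw [mem_block_iff hj] at hx
  have hq := hx ν
  have hdm := Nat.div_add_mod (x ν).val P.L
  rw [hq] at hdm
  have hle : ((toFinest z) ν).val ≤ ((toFinest x) ν).val := by
    rw [val_toFinest hj z, val_toFinest hj.le x, pow_succ]
    calc (z ν).val * (P.L ^ j * P.L) = P.L * (z ν).val * P.L ^ j := by ring
      _ ≤ (x ν).val * P.L ^ j := Nat.mul_le_mul_right _ (by omega)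
  rw [ZMod.val_sub hle, val_toFinest hj z, val_toFinest hj.le x, pow_succ]
  have e : (x ν).val * P.L ^ j = (z ν).val * (P.L ^ j * P.L) + P.L ^ j * ((x ν).val % P.L) := by
    conv_lhs => rw [← hdm]
    ring
  rw [e, Nat.add_sub_cancel_left]

/-- **THE HUB BOUND** (`z ∈ T⁽ʲ⁺¹⁾`, `x ∈ B(z)`, `j < K`, any `W : T⁽ʲ⁾ → ℝ^N`, any `Ã`): transporting `W(x)` to the block
corner along the staircase `Γ_{z,x}` ((I.2.1), (I.2.7)) and telescoping through the level-`j` bonds of the staircase with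
the coarse transports `U(Lʲε·Ā⁽ʲ⁾) = U(ε·Σ_{straight}Ã)` ((II.2.55)),
`|U(Ã(Γ_{z,x}))W(x) − W(z)| ≤ Σ_ν Σ_{m < x_ν mod L} (Lʲε)|(D^{Lʲε}_{Ā⁽ʲ⁾}W)(⟨c_{ν,m}, ν⟩)|`, `c_{ν,m}` the `m`-th level-`j` site
of the `ν`-segment of the staircase. [cite: Balaban1982Higgs1, (2.7) p.608] [cite: Balaban1982Higgs2, (2.16) p.559, (2.55) p.570] -/
theorem norm_transport_sub_hub_le (hj : j < P.K) (C : ChargeData N) (A : VecField P 0) (W : ScalarField P j N)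
    (z : Site P (j + 1)) {x : Site P j} (hx : x ∈ block z) :
    ‖C.U (P.mesh 0) (contourSum A (toFinest z) (toFinest x)) (W x) - W (blockIter j (toFinest z))‖
      ≤ ∑ ν : Fin P.d, ∑ m ∈ Finset.range ((x ν).val % P.L), P.mesh j *
          ‖covDeriv C (barA j A) W
            ⟨blockIter j (shiftN (cornerN (toFinest z) (toFinest x) (ν + 1)) ν (P.L ^ j * m)), ν⟩‖ := by
  set Z := toFinest z with hZ
  set X := toFinest x with hX
  set n : ℕ := P.L ^ j with hn
  -- the summand family
  set f : Fin P.d → ℝ := fun ν => ∑ m ∈ Finset.range ((x ν).val % P.L), P.mesh j *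
    ‖covDeriv C (barA j A) W ⟨blockIter j (shiftN (cornerN Z X (ν + 1)) ν (n * m)), ν⟩‖ with hf
  have hf0 : ∀ ν, 0 ≤ f ν := fun ν =>
    Finset.sum_nonneg fun _ _ => mul_nonneg (P.mesh_pos j).le (norm_nonneg _)
  -- induction over the corners `cornerN Z X t`, `t = 0, …, d`
  suffices H : ∀ t : ℕ, t ≤ P.d →
      ‖C.U (P.mesh 0) (contourSum A (cornerN Z X t) X) (W x) - W (blockIter j (cornerN Z X t))‖
        ≤ ∑ ν : Fin P.d, if (ν : ℕ) < t then f ν else 0 by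
    have h := H P.d le_rfl
    rw [cornerN_d] at h
    refine h.trans (le_of_eq (Finset.sum_congr rfl fun ν _ => ?_))
    rw [if_pos ν.isLt]
  intro t
  induction t with
  | zero =>
    intro _
    have hx0 : blockIter j X = x := blockIter_toFinest hj.le x
    simp [cornerN_zero, contourSum_self, ChargeData.U_zero, hx0]
  | succ t ih =>
    intro ht
    have ht' : t < P.d := ht
    set τ : Fin P.d := ⟨t, ht'⟩ with hτ
    have hih := ih ht'.le
    -- geometry of the corner `t+1`
    have hagree : ∀ i : Fin P.d, τ < i → cornerN Z X (t + 1) i = X i := by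
      intro i hi
      have : ¬ ((i : ℕ) < t + 1) := by
        have h := Fin.lt_def.mp hi; simp only [hτ] at h; omega
      simp [cornerN, this]
    have hct : cornerN Z X (t + 1) τ = Z τ := by simp [cornerN, hτ]
    have hsplit := contourSum_split A (cornerN Z X (t + 1)) X τ hagree
    rw [update_cornerN_succ Z X τ, hct] at hsplit
    have hsteps : (X τ - Z τ).val = n * ((x τ).val % P.L) := val_toFinest_sub hj hx τ
    have hend : shiftN (cornerN Z X (t + 1)) τ (n * ((x τ).val % P.L)) = cornerN Z X t := by
      rw [← hsteps]; exact shiftN_cornerN_succ Z X τ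
    -- the segment from corner `t+1` to corner `t`, telescoped through its `x_τ mod L` level-`j` bonds
    set p : ℕ → Site P 0 := fun m => shiftN (cornerN Z X (t + 1)) τ (n * m) with hp
    have hp_fin : ∀ m, toFinest (blockIter j (p m)) = p m := by
      intro m
      simp only [hp]
      rw [hn, toFinest_blockIter_shiftN hj.le, toFinest_blockIter_cornerN hj]
    have hp_shift : ∀ m, (blockIter j (p m)).shift τ = blockIter j (p (m + 1)) := by
      intro m
      simp only [hp]
      rw [← blockIter_shiftN_pow hj.le, shiftN_add, hn, Nat.mul_add_one]
    have hterm : ∀ m, ‖C.U (P.mesh 0) (segSum A (p m) τ n) (W (blockIter j (p (m + 1)))) - W (blockIter j (p m))‖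
        = P.mesh j * ‖covDeriv C (barA j A) W ⟨blockIter j (p m), τ⟩‖ := by
      intro m
      have hcd : covDeriv C (barA j A) W ⟨blockIter j (p m), τ⟩
          = (P.mesh j)⁻¹ • (C.U (P.mesh 0) (segSum A (p m) τ n) (W (blockIter j (p (m + 1)))) - W (blockIter j (p m))) := by
        simp only [HiggsLattice.covDeriv, PBond.tgt]
        rw [U_mesh_barA, hp_fin, hp_shift]
      rw [hcd, norm_smul, Real.norm_eq_abs, abs_of_pos (inv_pos.2 (P.mesh_pos j)), ← mul_assoc,
        mul_inv_cancel₀ (P.mesh_pos j).ne', one_mul]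
    have hseg : ‖C.U (P.mesh 0) (segSum A (cornerN Z X (t + 1)) τ (n * ((x τ).val % P.L)))
        (W (blockIter j (cornerN Z X t))) - W (blockIter j (cornerN Z X (t + 1)))‖ ≤ f τ := by
      have h := norm_U_sum_sub_le C (P.mesh 0) (fun m => segSum A (p m) τ n) (fun m => W (blockIter j (p m)))
        ((x τ).val % P.L)
      have e0 : p 0 = cornerN Z X (t + 1) := by simp only [hp]; rw [mul_zero, shiftN_zero']
      have eT : p ((x τ).val % P.L) = cornerN Z X t := hend
      rw [← segSum_mul_len, e0, eT] at h
      refine h.trans (le_of_eq ?_)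
      simp only [hf]
      exact Finset.sum_congr rfl fun m _ => hterm m
    -- assemble
    rw [hsplit, hsteps, ChargeData.U_add, mul_apply_eq_comp]
    have key : C.U (P.mesh 0) (segSum A (cornerN Z X (t + 1)) τ (n * ((x τ).val % P.L)))
          (C.U (P.mesh 0) (contourSum A (cornerN Z X t) X) (W x)) - W (blockIter j (cornerN Z X (t + 1)))
        = C.U (P.mesh 0) (segSum A (cornerN Z X (t + 1)) τ (n * ((x τ).val % P.L)))
            (C.U (P.mesh 0) (contourSum A (cornerN Z X t) X) (W x) - W (blockIter j (cornerN Z X t)))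
          + (C.U (P.mesh 0) (segSum A (cornerN Z X (t + 1)) τ (n * ((x τ).val % P.L)))
              (W (blockIter j (cornerN Z X t))) - W (blockIter j (cornerN Z X (t + 1)))) := by
      rw [map_sub]; abel
    rw [key]
    refine (norm_add_le _ _).trans ?_
    rw [norm_U_apply]
    -- the partial sums: `S(t+1) = S(t) + f τ`
    have hS : (∑ ν : Fin P.d, if (ν : ℕ) < t + 1 then f ν else 0)
        = (∑ ν : Fin P.d, if (ν : ℕ) < t then f ν else 0) + f τ := by
      have e : ∀ ν : Fin P.d, (if (ν : ℕ) < t + 1 then f ν else 0)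
          = (if (ν : ℕ) < t then f ν else 0) + (if ν = τ then f ν else 0) := by
        intro ν
        by_cases h1 : (ν : ℕ) < t
        · have h2 : ν ≠ τ := fun h => by rw [h, hτ] at h1; exact lt_irrefl _ h1
          rw [if_pos (Nat.lt_succ_of_lt h1), if_pos h1, if_neg h2, add_zero]
        · by_cases h2 : ν = τ
          · subst h2
            rw [if_pos (by simp [hτ]), if_neg h1, if_pos rfl, zero_add]
          · have h3 : ¬ ((ν : ℕ) < t + 1) := fun h => by
              have : (ν : ℕ) ≠ t := fun h' => h2 (Fin.ext h'); omega
            rw [if_neg h3, if_neg h1, if_neg h2, add_zero]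
      rw [Finset.sum_congr rfl fun ν _ => e ν, Finset.sum_add_distrib, Finset.sum_ite_eq' Finset.univ τ,
        if_pos (Finset.mem_univ τ)]
    rw [hS]
    exact add_le_add hih hseg

end Hub

/-! ## §4 The staircase bonds lie in the block, are distinct, and the variance of a block is bounded by its level-`j` energy -/

section Variance

variable {j : ℕ}

/-- The labels of the block corner are below those of the block's sites: `z̃_i ≤ x̃_i` (`x ∈ B(z)`, `j < K`).
[cite: Balaban1982Higgs1, (1.17) p.606] -/
theorem val_toFinest_le (hj : j < P.K) {z : Site P (j + 1)} {x : Site P j} (hx : x ∈ block z) (i : Fin P.d) :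
    ((toFinest z) i).val ≤ ((toFinest x) i).val := by
  rw [mem_block_iff hj] at hx
  have hdm := Nat.div_add_mod (x i).val P.L
  rw [hx i] at hdm
  rw [val_toFinest hj z, val_toFinest hj.le x, pow_succ]
  calc (z i).val * (P.L ^ j * P.L) = P.L * (z i).val * P.L ^ j := by ring
    _ ≤ (x i).val * P.L ^ j := Nat.mul_le_mul_right _ (by omega)

/-- **A site of `T_ε` whose labels lie between those of `z̃` and of some `x̃`, `x ∈ B(z)`, has `(j+1)`-block point `z`**
(the blocks are coordinate boxes, (I.1.17)). [cite: Balaban1982Higgs1, (1.17) p.606, (1.20) p.607] -/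
theorem blockIter_succ_eq_of_window (hj : j < P.K) {z : Site P (j + 1)} {x : Site P j} (hx : x ∈ block z)
    (p : Site P 0) (hp : ∀ i, ((toFinest z) i).val ≤ (p i).val ∧ (p i).val ≤ ((toFinest x) i).val) :
    blockIter (j + 1) p = z := by
  rw [mem_block_iff hj] at hx
  funext i
  apply ZMod.val_injective
  rw [val_blockIter hj]
  obtain ⟨h1, h2⟩ := hp i
  rw [val_toFinest hj z] at h1
  rw [val_toFinest hj.le x] at h2
  have hdm := Nat.div_add_mod (x i).val P.L
  rw [hx i] at hdm
  have hmod := Nat.mod_lt (x i).val P.hL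
  have hLj : 0 < P.L ^ j := pow_pos P.hL j
  refine Nat.div_eq_of_lt_le h1 ?_
  calc (p i).val ≤ (x i).val * P.L ^ j := h2
    _ < ((z i).val + 1) * P.L ^ (j + 1) := by
        rw [pow_succ]
        have : (x i).val < ((z i).val + 1) * P.L := by nlinarith
        nlinarith

/-- The sites of the `ν`-segment of the staircase `Γ_{z,x}` at the level-`j` steps are images of level-`j` sites.
[cite: Balaban1982Higgs1, (2.1) p.608] -/
theorem toFinest_blockIter_stair (hj : j < P.K) (z : Site P (j + 1)) (x : Site P j) (ν : Fin P.d) (m : ℕ) :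
    toFinest (blockIter j (shiftN (cornerN (toFinest z) (toFinest x) (ν + 1)) ν (P.L ^ j * m)))
      = shiftN (cornerN (toFinest z) (toFinest x) (ν + 1)) ν (P.L ^ j * m) := by
  rw [toFinest_blockIter_shiftN hj.le, toFinest_blockIter_cornerN hj]

/-- Consecutive level-`j` sites of the `ν`-segment are joined by a level-`j` bond in direction `ν`.
[cite: Balaban1982Higgs1, (2.1) p.608] -/
theorem blockIter_stair_shift (hj : j < P.K) (z : Site P (j + 1)) (x : Site P j) (ν : Fin P.d) (m : ℕ) :
    (blockIter j (shiftN (cornerN (toFinest z) (toFinest x) (ν + 1)) ν (P.L ^ j * m))).shift ν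
      = blockIter j (shiftN (cornerN (toFinest z) (toFinest x) (ν + 1)) ν (P.L ^ j * (m + 1))) := by
  rw [← blockIter_shiftN_pow hj.le, shiftN_add, Nat.mul_add_one]

/-- The sites of the `ν`-segment (up to and including its endpoint, `m ≤ x_ν mod L`) lie in the label window of the
block. [cite: Balaban1982Higgs1, (1.17) p.606, (2.1) p.608] -/
theorem stair_window (hj : j < P.K) {z : Site P (j + 1)} {x : Site P j} (hx : x ∈ block z) (ν : Fin P.d) {m : ℕ}
    (hm : m ≤ (x ν).val % P.L) (i : Fin P.d) :
    ((toFinest z) i).val ≤ ((shiftN (cornerN (toFinest z) (toFinest x) (ν + 1)) ν (P.L ^ j * m)) i).val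
      ∧ ((shiftN (cornerN (toFinest z) (toFinest x) (ν + 1)) ν (P.L ^ j * m)) i).val ≤ ((toFinest x) i).val := by
  have hZX := val_toFinest_le hj hx
  by_cases hi : i = ν
  · subst hi
    have hsub := val_toFinest_sub hj hx i
    have hle := hZX i
    rw [ZMod.val_sub hle] at hsub
    have hc : (cornerN (toFinest z) (toFinest x) (i + 1)) i = (toFinest z) i := by simp [cornerN]
    have hlt : ((toFinest z) i).val + P.L ^ j * m < P.sitesPerDir 0 i := by
      have := ZMod.val_lt ((toFinest x) i)
      have := Nat.mul_le_mul_left (P.L ^ j) hm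
      omega
    rw [val_shiftN, hc, Nat.mod_eq_of_lt hlt]
    have := Nat.mul_le_mul_left (P.L ^ j) hm
    constructor <;> omega
  · rw [shiftN_apply_ne _ hi]
    simp only [cornerN]
    split_ifs
    · exact ⟨le_rfl, hZX i⟩
    · exact ⟨hZX i, le_rfl⟩

/-- **The level-`j` sites of the staircase `Γ_{z,x}` lie in `B(z)`** (`m ≤ x_ν mod L`). [cite: Balaban1982Higgs1, (1.17) p.606, (2.1) p.608] -/
theorem blockIter_stair_mem_block (hj : j < P.K) {z : Site P (j + 1)} {x : Site P j} (hx : x ∈ block z)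
    (ν : Fin P.d) {m : ℕ} (hm : m ≤ (x ν).val % P.L) :
    blockIter j (shiftN (cornerN (toFinest z) (toFinest x) (ν + 1)) ν (P.L ^ j * m)) ∈ block z := by
  have h := blockIter_succ_eq_of_window hj hx _ (stair_window hj hx ν hm)
  rw [blockIter_succ] at h
  simp [block, h]

/-- The level-`j` sites of the `ν`-segment are pairwise distinct (`m, m′ ≤ x_ν mod L`). [cite: Balaban1982Higgs1, (2.1) p.608] -/
theorem blockIter_stair_inj (hj : j < P.K) {z : Site P (j + 1)} {x : Site P j} (hx : x ∈ block z) (ν : Fin P.d)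
    {m m' : ℕ} (hm : m ≤ (x ν).val % P.L) (hm' : m' ≤ (x ν).val % P.L)
    (h : blockIter j (shiftN (cornerN (toFinest z) (toFinest x) (ν + 1)) ν (P.L ^ j * m))
      = blockIter j (shiftN (cornerN (toFinest z) (toFinest x) (ν + 1)) ν (P.L ^ j * m'))) : m = m' := by
  have h0 := congrArg toFinest h
  rw [toFinest_blockIter_stair hj, toFinest_blockIter_stair hj] at h0
  have h1 : ((shiftN (cornerN (toFinest z) (toFinest x) (ν + 1)) ν (P.L ^ j * m)) ν).val
      = ((shiftN (cornerN (toFinest z) (toFinest x) (ν + 1)) ν (P.L ^ j * m')) ν).val := by rw [h0]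
  have w1 := (stair_window hj hx ν hm ν)
  have w2 := (stair_window hj hx ν hm' ν)
  have hc : (cornerN (toFinest z) (toFinest x) (ν + 1)) ν = (toFinest z) ν := by simp [cornerN]
  have hX := ZMod.val_lt ((toFinest x) ν)
  have hlt1 : ((toFinest z) ν).val + P.L ^ j * m < P.sitesPerDir 0 ν := by
    have := Nat.mul_le_mul_left (P.L ^ j) hm
    have hsub := val_toFinest_sub hj hx ν
    rw [ZMod.val_sub (val_toFinest_le hj hx ν)] at hsub
    omega
  have hlt2 : ((toFinest z) ν).val + P.L ^ j * m' < P.sitesPerDir 0 ν := by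
    have := Nat.mul_le_mul_left (P.L ^ j) hm'
    have hsub := val_toFinest_sub hj hx ν
    rw [ZMod.val_sub (val_toFinest_le hj hx ν)] at hsub
    omega
  rw [val_shiftN, val_shiftN, hc, Nat.mod_eq_of_lt hlt1, Nat.mod_eq_of_lt hlt2] at h1
  have hLj : 0 < P.L ^ j := pow_pos P.hL j
  have := Nat.eq_of_mul_eq_mul_left hLj (by omega : P.L ^ j * m = P.L ^ j * m')
  exact this

/-- **The hub bound, squared** (Cauchy–Schwarz over the `≤ d(L−1)` level-`j` bonds of the staircase):
`|U(Ã(Γ_{z,x}))W(x) − W(z)|² ≤ d(L−1) Σ_ν Σ_{m < x_ν mod L} (Lʲε)²|(D_{Ā⁽ʲ⁾}W)(⟨c_{ν,m},ν⟩)|²`. [cite: Balaban1982Higgs1, (2.7) p.608]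
[cite: Balaban1983RegularityDecay, (1.22) p.574] -/
theorem norm_transport_sub_hub_sq_le (hj : j < P.K) (C : ChargeData N) (A : VecField P 0) (W : ScalarField P j N)
    (z : Site P (j + 1)) {x : Site P j} (hx : x ∈ block z) :
    ‖C.U (P.mesh 0) (contourSum A (toFinest z) (toFinest x)) (W x) - W (blockIter j (toFinest z))‖ ^ 2
      ≤ P.d * ((P.L : ℝ) - 1) * ∑ ν : Fin P.d, ∑ m ∈ Finset.range ((x ν).val % P.L), P.mesh j ^ 2 *
          ‖covDeriv C (barA j A) W
            ⟨blockIter j (shiftN (cornerN (toFinest z) (toFinest x) (ν + 1)) ν (P.L ^ j * m)), ν⟩‖ ^ 2 := by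
  have h := norm_transport_sub_hub_le hj C A W z hx
  set f : Fin P.d → ℝ := fun ν => ∑ m ∈ Finset.range ((x ν).val % P.L), P.mesh j *
    ‖covDeriv C (barA j A) W
      ⟨blockIter j (shiftN (cornerN (toFinest z) (toFinest x) (ν + 1)) ν (P.L ^ j * m)), ν⟩‖ with hf
  have hf0 : ∀ ν, 0 ≤ f ν := fun ν =>
    Finset.sum_nonneg fun _ _ => mul_nonneg (P.mesh_pos j).le (norm_nonneg _)
  have hL1 : ∀ ν : Fin P.d, ((Finset.range ((x ν).val % P.L)).card : ℝ) ≤ (P.L : ℝ) - 1 := by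
    intro ν
    rw [Finset.card_range]
    have hlt : (x ν).val % P.L < P.L := Nat.mod_lt _ P.hL
    have : (((x ν).val % P.L : ℕ) : ℝ) + 1 ≤ (P.L : ℝ) := by exact_mod_cast Nat.succ_le_of_lt hlt
    linarith
  -- Cauchy–Schwarz twice
  have h1 : (∑ ν : Fin P.d, f ν) ^ 2 ≤ P.d * ∑ ν : Fin P.d, f ν ^ 2 := by
    have := sq_sum_le_card_mul_sum_sq (s := (Finset.univ : Finset (Fin P.d))) (f := f)
    rwa [Finset.card_univ, Fintype.card_fin] at this
  have h2 : ∀ ν : Fin P.d, f ν ^ 2 ≤ ((P.L : ℝ) - 1) * ∑ m ∈ Finset.range ((x ν).val % P.L), P.mesh j ^ 2 *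
      ‖covDeriv C (barA j A) W
        ⟨blockIter j (shiftN (cornerN (toFinest z) (toFinest x) (ν + 1)) ν (P.L ^ j * m)), ν⟩‖ ^ 2 := by
    intro ν
    have hcs := sq_sum_le_card_mul_sum_sq (s := Finset.range ((x ν).val % P.L)) (f := fun m => P.mesh j *
      ‖covDeriv C (barA j A) W
        ⟨blockIter j (shiftN (cornerN (toFinest z) (toFinest x) (ν + 1)) ν (P.L ^ j * m)), ν⟩‖)
    refine hcs.trans ?_
    simp_rw [mul_pow]
    exact mul_le_mul_of_nonneg_right (hL1 ν) (Finset.sum_nonneg fun _ _ => mul_nonneg (sq_nonneg _) (sq_nonneg _))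
  have hsq : ‖C.U (P.mesh 0) (contourSum A (toFinest z) (toFinest x)) (W x) - W (blockIter j (toFinest z))‖ ^ 2
      ≤ (∑ ν : Fin P.d, f ν) ^ 2 := by
    have h0 : 0 ≤ ∑ ν : Fin P.d, f ν := Finset.sum_nonneg fun ν _ => hf0 ν
    exact pow_le_pow_left₀ (norm_nonneg _) h 2
  refine hsq.trans (h1.trans ?_)
  rw [mul_assoc]
  refine mul_le_mul_of_nonneg_left ?_ (Nat.cast_nonneg _)
  rw [Finset.mul_sum]
  exact Finset.sum_le_sum fun ν _ => h2 ν

/-- **Multiplicity**: over the sites `x` of a block, the staircase bonds meet each level-`j` bond of the block at most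
`L^d = |B(z)|` times (for fixed `x` and `ν` the bonds `⟨c_{ν,m}, ν⟩` are distinct bonds of `B(z)`):
`Σ_{x∈B(z)} Σ_ν Σ_{m<x_ν mod L} G(⟨c_{ν,m},ν⟩) ≤ L^d Σ_{c ⊂ B(z)} G(c)` for `G ≥ 0`. [cite: Balaban1982Higgs1, (1.17) p.606, (2.1) p.608] -/
theorem sum_stair_le (hj : j < P.K) (z : Site P (j + 1)) (G : PBond P j → ℝ) (hG : ∀ c, 0 ≤ G c) :
    ∑ x ∈ block z, ∑ ν : Fin P.d, ∑ m ∈ Finset.range ((x ν).val % P.L),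
        G ⟨blockIter j (shiftN (cornerN (toFinest z) (toFinest x) (ν + 1)) ν (P.L ^ j * m)), ν⟩
      ≤ (P.L : ℝ) ^ P.d * ∑ c : PBond P j, if c.src ∈ block z ∧ c.tgt ∈ block z then G c else 0 := by
  classical
  -- for one site: the image of `m ↦ ⟨c_{ν,m}, ν⟩` is a set of distinct bonds of `B(z)` with direction `ν`
  have hone : ∀ x ∈ block z, ∑ ν : Fin P.d, ∑ m ∈ Finset.range ((x ν).val % P.L),
      G ⟨blockIter j (shiftN (cornerN (toFinest z) (toFinest x) (ν + 1)) ν (P.L ^ j * m)), ν⟩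
        ≤ ∑ c : PBond P j, if c.src ∈ block z ∧ c.tgt ∈ block z then G c else 0 := by
    intro x hx
    have hν : ∀ ν : Fin P.d, ∑ m ∈ Finset.range ((x ν).val % P.L),
        G ⟨blockIter j (shiftN (cornerN (toFinest z) (toFinest x) (ν + 1)) ν (P.L ^ j * m)), ν⟩
          ≤ ∑ c : PBond P j, if (c.src ∈ block z ∧ c.tgt ∈ block z) ∧ c.dir = ν then G c else 0 := by
      intro ν
      set φ : ℕ → PBond P j :=
        fun m => ⟨blockIter j (shiftN (cornerN (toFinest z) (toFinest x) (ν + 1)) ν (P.L ^ j * m)), ν⟩ with hφ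
      have hinj : Set.InjOn φ (Finset.range ((x ν).val % P.L) : Set ℕ) := by
        intro m hm m' hm' hmm
        have hm1 : m ≤ (x ν).val % P.L := (Finset.mem_range.1 (Finset.mem_coe.1 hm)).le
        have hm2 : m' ≤ (x ν).val % P.L := (Finset.mem_range.1 (Finset.mem_coe.1 hm')).le
        exact blockIter_stair_inj hj hx ν hm1 hm2 (congrArg PBond.src hmm)
      rw [← Finset.sum_image (f := G) hinj, ← Finset.sum_filter]
      refine Finset.sum_le_sum_of_subset_of_nonneg ?_ (fun c _ _ => hG c)
      intro c hc
      obtain ⟨m, hm, rfl⟩ := Finset.mem_image.1 hc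
      have hm1 : m < (x ν).val % P.L := Finset.mem_range.1 hm
      rw [Finset.mem_filter]
      refine ⟨Finset.mem_univ _, ⟨?_, ?_⟩, rfl⟩
      · exact blockIter_stair_mem_block hj hx ν hm1.le
      · show (blockIter j _).shift ν ∈ block z
        rw [blockIter_stair_shift hj]
        exact blockIter_stair_mem_block hj hx ν hm1
    refine (Finset.sum_le_sum fun ν _ => hν ν).trans (le_of_eq ?_)
    rw [Finset.sum_comm]
    refine Finset.sum_congr rfl fun c _ => ?_
    by_cases hc : c.src ∈ block z ∧ c.tgt ∈ block z
    · simp only [hc, true_and, if_true]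
      rw [Finset.sum_ite_eq Finset.univ c.dir, if_pos (Finset.mem_univ _)]
    · simp [hc]
  calc ∑ x ∈ block z, ∑ ν : Fin P.d, ∑ m ∈ Finset.range ((x ν).val % P.L),
        G ⟨blockIter j (shiftN (cornerN (toFinest z) (toFinest x) (ν + 1)) ν (P.L ^ j * m)), ν⟩
      ≤ ∑ x ∈ block z, ∑ c : PBond P j, (if c.src ∈ block z ∧ c.tgt ∈ block z then G c else 0) :=
        Finset.sum_le_sum hone
    _ = (P.L : ℝ) ^ P.d * ∑ c : PBond P j, if c.src ∈ block z ∧ c.tgt ∈ block z then G c else 0 := by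
        rw [Finset.sum_const, card_block hj, nsmul_eq_mul]
        push_cast
        ring

/-- **THE VARIANCE OF A BLOCK IS BOUNDED BY ITS LEVEL-`j` ENERGY**: for `z ∈ T⁽ʲ⁺¹⁾` (`j < K`), any `W : T⁽ʲ⁾ → ℝ^N`, any `Ã`,
`Σ_{x∈B(z)} |U(Ã(Γ_{z,x}))W(x) − W(z)|² ≤ d(L−1)L^d (Lʲε)² Σ_{c⊂B(z)} |(D^{Lʲε}_{Ā⁽ʲ⁾}W)(c)|²`. [cite: Balaban1982Higgs1, (2.7) p.608]
[cite: Balaban1983RegularityDecay, (1.22) p.574] -/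
theorem var_block_le (hj : j < P.K) (C : ChargeData N) (A : VecField P 0) (W : ScalarField P j N)
    (z : Site P (j + 1)) :
    ∑ x ∈ block z, ‖C.U (P.mesh 0) (contourSum A (toFinest z) (toFinest x)) (W x) - W (blockIter j (toFinest z))‖ ^ 2
      ≤ P.d * ((P.L : ℝ) - 1) * (P.L : ℝ) ^ P.d * P.mesh j ^ 2 *
          ∑ c : PBond P j, if c.src ∈ block z ∧ c.tgt ∈ block z then ‖covDeriv C (barA j A) W c‖ ^ 2 else 0 := by
  have hL1 : 0 ≤ (P.L : ℝ) - 1 := by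
    have : (1 : ℝ) ≤ P.L := by exact_mod_cast P.hL
    linarith
  have hdL : 0 ≤ (P.d : ℝ) * ((P.L : ℝ) - 1) := mul_nonneg (Nat.cast_nonneg _) hL1
  calc ∑ x ∈ block z,
        ‖C.U (P.mesh 0) (contourSum A (toFinest z) (toFinest x)) (W x) - W (blockIter j (toFinest z))‖ ^ 2
      ≤ ∑ x ∈ block z, P.d * ((P.L : ℝ) - 1) * ∑ ν : Fin P.d, ∑ m ∈ Finset.range ((x ν).val % P.L),
          P.mesh j ^ 2 * ‖covDeriv C (barA j A) W
            ⟨blockIter j (shiftN (cornerN (toFinest z) (toFinest x) (ν + 1)) ν (P.L ^ j * m)), ν⟩‖ ^ 2 :=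
        Finset.sum_le_sum fun x hx => norm_transport_sub_hub_sq_le hj C A W z hx
    _ = P.d * ((P.L : ℝ) - 1) * ∑ x ∈ block z, ∑ ν : Fin P.d, ∑ m ∈ Finset.range ((x ν).val % P.L),
          P.mesh j ^ 2 * ‖covDeriv C (barA j A) W
            ⟨blockIter j (shiftN (cornerN (toFinest z) (toFinest x) (ν + 1)) ν (P.L ^ j * m)), ν⟩‖ ^ 2 := by
        rw [Finset.mul_sum]
    _ ≤ P.d * ((P.L : ℝ) - 1) * ((P.L : ℝ) ^ P.d * ∑ c : PBond P j,
          if c.src ∈ block z ∧ c.tgt ∈ block z then P.mesh j ^ 2 * ‖covDeriv C (barA j A) W c‖ ^ 2 else 0) :=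
        mul_le_mul_of_nonneg_left (sum_stair_le hj z (fun c => P.mesh j ^ 2 * ‖covDeriv C (barA j A) W c‖ ^ 2)
          fun c => mul_nonneg (sq_nonneg _) (sq_nonneg _)) hdL
    _ = P.d * ((P.L : ℝ) - 1) * (P.L : ℝ) ^ P.d * P.mesh j ^ 2 *
          ∑ c : PBond P j, if c.src ∈ block z ∧ c.tgt ∈ block z then ‖covDeriv C (barA j A) W c‖ ^ 2 else 0 := by
        simp only [Finset.mul_sum, mul_ite, mul_zero]
        refine Finset.sum_congr rfl fun c _ => ?_
        split_ifs <;> ring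

end Variance

/-! ## §5 The level sets `Ω_j` of `Ω = Bᵏ(Λ)`, one level of the inequality on `Ω`, and the sum over the levels -/

section Levels

variable {k : ℕ}

/-- **`Ω_j = ⋃_{z∈Ω_{j+1}} B(z)`** for the level sets `Ω_j = {q ∈ T⁽ʲ⁾ : Bʲ(q) ⊂ Bᵏ(Λ)}` of `Ω = Bᵏ(Λ)` (`j + 1 ≤ k ≤ K`):
a sum over `Ω_j` is the sum over the blocks of the sites of `Ω_{j+1}`. [cite: Balaban1982Higgs1, (1.18)–(1.20) p.607] -/
theorem sum_level_succ {j : ℕ} (hjk : j + 1 ≤ k) (hk : k ≤ P.K) (Λ : Finset (Site P k)) (F : Site P j → ℝ) :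
    ∑ q ∈ Finset.univ.filter (fun q : Site P j => blockIter k (toFinest q) ∈ Λ), F q
      = ∑ z ∈ Finset.univ.filter (fun z : Site P (j + 1) => blockIter k (toFinest z) ∈ Λ), ∑ x ∈ block z, F x := by
  classical
  have hmaps : ∀ q ∈ Finset.univ.filter (fun q : Site P j => blockIter k (toFinest q) ∈ Λ),
      blockOf q ∈ Finset.univ.filter (fun z : Site P (j + 1) => blockIter k (toFinest z) ∈ Λ) := by
    intro q hq
    rw [Finset.mem_filter] at hq ⊢
    exact ⟨Finset.mem_univ _, by rw [← blockIter_toFinest_eq_blockOf hjk hk]; exact hq.2⟩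
  rw [← Finset.sum_fiberwise_of_maps_to hmaps]
  refine Finset.sum_congr rfl fun z hz => ?_
  refine Finset.sum_congr ?_ fun _ _ => rfl
  rw [Finset.mem_filter] at hz
  ext q
  simp only [Finset.mem_filter, Finset.mem_univ, true_and, block]
  constructor
  · exact fun h => h.2
  · intro h
    refine ⟨?_, h⟩
    rw [blockIter_toFinest_eq_blockOf hjk hk, h]
    exact hz.2

/-- **The blocks of distinct coarse sites have disjoint bond sets**: summing a non-negative bond function over the bonds
inside the blocks `B(z)`, `z ∈ Ω_{j+1}`, gives at most its sum over the bonds inside `Ω_j`. [cite: Balaban1982Higgs1, (1.17)–(1.18) pp.606–607] -/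
theorem sum_blocks_le_inside {j : ℕ} (hjk : j + 1 ≤ k) (hk : k ≤ P.K) (Λ : Finset (Site P k)) (G : PBond P j → ℝ)
    (hG : ∀ c, 0 ≤ G c) :
    ∑ z ∈ Finset.univ.filter (fun z : Site P (j + 1) => blockIter k (toFinest z) ∈ Λ),
        ∑ c : PBond P j, (if c.src ∈ block z ∧ c.tgt ∈ block z then G c else 0)
      ≤ ∑ c : PBond P j,
          if Inside (Finset.univ.filter (fun q : Site P j => blockIter k (toFinest q) ∈ Λ)) c then G c else 0 := by
  classical
  rw [Finset.sum_comm]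
  refine Finset.sum_le_sum fun c _ => ?_
  have hmem : ∀ (z : Site P (j + 1)) (q : Site P j), q ∈ block z ↔ blockOf q = z := by
    intro z q; simp [block]
  have e : ∀ z : Site P (j + 1), (if c.src ∈ block z ∧ c.tgt ∈ block z then G c else 0)
      = if blockOf c.src = z then (if blockOf c.tgt = z then G c else 0) else 0 := by
    intro z
    by_cases h1 : blockOf c.src = z
    · by_cases h2 : blockOf c.tgt = z
      · rw [if_pos ⟨(hmem _ _).2 h1, (hmem _ _).2 h2⟩, if_pos h1, if_pos h2]
      · rw [if_neg (fun h => h2 ((hmem _ _).1 h.2)), if_pos h1, if_neg h2]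
    · rw [if_neg (fun h => h1 ((hmem _ _).1 h.1)), if_neg h1]
  simp_rw [e]
  rw [Finset.sum_ite_eq]
  by_cases hin : Inside (Finset.univ.filter (fun q : Site P j => blockIter k (toFinest q) ∈ Λ)) c
  · rw [if_pos hin]
    split_ifs
    · exact le_rfl
    · exact hG c
    · exact hG c
  · rw [if_neg hin]
    split_ifs with h1 h2
    · exfalso
      apply hin
      rw [Finset.mem_filter] at h1
      constructor
      · rw [Finset.mem_filter, blockIter_toFinest_eq_blockOf hjk hk]
        exact ⟨Finset.mem_univ _, h1.2⟩
      · rw [Finset.mem_filter, blockIter_toFinest_eq_blockOf hjk hk, h2]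
        exact ⟨Finset.mem_univ _, h1.2⟩
    · exact le_rfl
    · exact le_rfl

/-- **One level of the block Poincaré inequality on `Ω = Bᵏ(Λ)`** (`j + 1 ≤ k ≤ K`, `W_j = Q_j(Ã)v`):
`Σ_{q∈Ω_j}(Lʲε)^d|W_j(q)|² ≤ Σ_{z∈Ω_{j+1}}(Lʲ⁺¹ε)^d|W_{j+1}(z)|² + d(L−1)L^d(Lʲε)² Σ_{c⊂Ω_j}(Lʲε)^d|(D_{Ā⁽ʲ⁾}W_j)(c)|²`.
[cite: Balaban1982Higgs1, (2.11) p.609] [cite: Balaban1983RegularityDecay, (1.22) p.574] -/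
theorem level_step {j : ℕ} (hjk : j + 1 ≤ k) (hk : k ≤ P.K) (C : ChargeData N) (A : VecField P 0)
    (Λ : Finset (Site P k)) (v : ScalarField P 0 N) :
    ∑ q ∈ Finset.univ.filter (fun q : Site P j => blockIter k (toFinest q) ∈ Λ),
        P.mesh j ^ P.d * ‖avgQk C A j v q‖ ^ 2
      ≤ (∑ z ∈ Finset.univ.filter (fun z : Site P (j + 1) => blockIter k (toFinest z) ∈ Λ),
          P.mesh (j + 1) ^ P.d * ‖avgQk C A (j + 1) v z‖ ^ 2)
        + P.d * ((P.L : ℝ) - 1) * (P.L : ℝ) ^ P.d * P.mesh j ^ 2 *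
          ∑ c : PBond P j, if Inside (Finset.univ.filter (fun q : Site P j => blockIter k (toFinest q) ∈ Λ)) c then
            P.mesh j ^ P.d * ‖covDeriv C (barA j A) (avgQk C A j v) c‖ ^ 2 else 0 := by
  classical
  have hj : j < P.K := by omega
  set W := avgQk C A j v with hW
  set κ : ℝ := P.d * ((P.L : ℝ) - 1) * (P.L : ℝ) ^ P.d * P.mesh j ^ 2 with hκ
  have hL1 : 0 ≤ (P.L : ℝ) - 1 := by
    have : (1 : ℝ) ≤ P.L := by exact_mod_cast P.hL
    linarith
  have hκ0 : 0 ≤ κ := by rw [hκ]; positivity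
  have hm : 0 ≤ P.mesh j ^ P.d := pow_nonneg (P.mesh_pos j).le _
  rw [sum_level_succ hjk hk Λ]
  -- per block
  have hz : ∀ z : Site P (j + 1), ∑ x ∈ block z, P.mesh j ^ P.d * ‖W x‖ ^ 2
      ≤ P.mesh (j + 1) ^ P.d * ‖avgQk C A (j + 1) v z‖ ^ 2
        + κ * ∑ c : PBond P j, (if c.src ∈ block z ∧ c.tgt ∈ block z then
            P.mesh j ^ P.d * ‖covDeriv C (barA j A) W c‖ ^ 2 else 0) := by
    intro z
    have h1 := level_step_block hj C A v z (W (blockIter j (toFinest z)))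
    have h2 := var_block_le hj C A W z
    have h3 : P.mesh j ^ P.d * ∑ x ∈ block z,
        ‖C.U (P.mesh 0) (contourSum A (toFinest z) (toFinest x)) (W x) - W (blockIter j (toFinest z))‖ ^ 2
        ≤ κ * ∑ c : PBond P j, (if c.src ∈ block z ∧ c.tgt ∈ block z then
            P.mesh j ^ P.d * ‖covDeriv C (barA j A) W c‖ ^ 2 else 0) := by
      refine (mul_le_mul_of_nonneg_left h2 hm).trans (le_of_eq ?_)
      have hS : (∑ c : PBond P j, (if c.src ∈ block z ∧ c.tgt ∈ block z then
            P.mesh j ^ P.d * ‖covDeriv C (barA j A) W c‖ ^ 2 else 0))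
          = P.mesh j ^ P.d * ∑ c : PBond P j, (if c.src ∈ block z ∧ c.tgt ∈ block z then
            ‖covDeriv C (barA j A) W c‖ ^ 2 else 0) := by
        rw [Finset.mul_sum]
        refine Finset.sum_congr rfl fun c _ => ?_
        split_ifs <;> simp
      rw [hS, hκ]
      ring
    exact h1.trans (by rw [hW] at h3 ⊢; linarith)
  refine (Finset.sum_le_sum fun z _ => hz z).trans ?_
  rw [Finset.sum_add_distrib]
  refine add_le_add le_rfl ?_
  rw [← Finset.mul_sum]
  exact mul_le_mul_of_nonneg_left (sum_blocks_le_inside hjk hk Λ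
    (fun c => P.mesh j ^ P.d * ‖covDeriv C (barA j A) W c‖ ^ 2) fun c => mul_nonneg hm (sq_nonneg _)) hκ0

/-- **The level-`j` energy of `W_j = Q_j(Ã)v` on `Ω_j` is bounded by the level-0 energy**: the covariant averaging
inequality of file 2 at level `j` (`Bʲ(Ω_j) = Ω`): `Σ_{c⊂Ω_j}(Lʲε)^d|(D_{Ā⁽ʲ⁾}W_j)(c)|² ≤ 4Σ_{b⊂Ω}ε^d|(D_Ã v)(b)|² +
8d³e²L^{2j}δ²Σ_{x∈Ω}ε^d|v(x)|²`. [cite: Balaban1983RegularityDecay, (1.22) p.574; §4 pp.589–591] -/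
theorem energy_level_le {j : ℕ} (hjk : j ≤ k) (hk : k ≤ P.K) (C : ChargeData N) (A : VecField P 0)
    (Λ : Finset (Site P k)) (Ω : Finset (Site P 0)) (hΩ : ∀ x, x ∈ Ω ↔ blockIter k x ∈ Λ) {δ : ℝ} (hδ : 0 ≤ δ)
    (hreg : ∀ z ∈ Ω, ∀ μ' ν : Fin P.d, |A ⟨z.shift ν, μ'⟩ - A ⟨z, μ'⟩| ≤ δ) (v : ScalarField P 0 N) :
    (∑ c : PBond P j, if Inside (Finset.univ.filter (fun q : Site P j => blockIter k (toFinest q) ∈ Λ)) c then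
        P.mesh j ^ P.d * ‖covDeriv C (barA j A) (avgQk C A j v) c‖ ^ 2 else 0)
      ≤ 4 * (∑ b : PBond P 0, if Inside Ω b then P.mesh 0 ^ P.d * ‖covDeriv C A v b‖ ^ 2 else 0)
        + 8 * (P.d : ℝ) ^ 3 * C.e ^ 2 * ((P.L : ℝ) ^ j) ^ 2 * δ ^ 2 * ∑ x ∈ Ω, P.mesh 0 ^ P.d * ‖v x‖ ^ 2 := by
  classical
  refine cov_averaging_ineq (hjk.trans hk) C A _ Ω (fun x => ?_) hδ hreg v
  rw [Finset.mem_filter, blockIter_toFinest_blockIter hjk hk, hΩ]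
  simp

/-- `(L − 1)·Σ_{j<k} qʲ ≤ qᵏ` for `q ≥ L` (`L ≥ 1`): the geometric sums over the levels. [folklore] -/
private theorem geom_level_sum_le {q : ℝ} (hq : (P.L : ℝ) ≤ q) :
    ∀ k : ℕ, ((P.L : ℝ) - 1) * ∑ j ∈ Finset.range k, q ^ j ≤ q ^ k := by
  have hL : (1 : ℝ) ≤ P.L := by exact_mod_cast P.hL
  have hq0 : 0 ≤ q := by linarith
  intro k
  induction k with
  | zero => simp
  | succ k ih =>
    rw [Finset.sum_range_succ, mul_add, pow_succ]
    have hqk : 0 ≤ q ^ k := pow_nonneg hq0 k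
    nlinarith

/-- **THE MULTILEVEL SUM** (`i ≤ k ≤ K`): `Σ_{x∈Ω}ε^d|v(x)|² ≤ Σ_{q∈Ω_i}(Lⁱε)^d|(Q_i(Ã)v)(q)|² +
Σ_{j<i} d(L−1)L^d(Lʲε)²·[4Σ_{b⊂Ω}ε^d|(D_Ã v)(b)|² + 8d³e²L^{2j}δ²Σ_{x∈Ω}ε^d|v(x)|²]` (telescoping `level_step` with
`energy_level_le`; `Ω_0 = Ω`, `Q_0 = 1`). [cite: Balaban1982Higgs1, (2.11) p.609] [cite: Balaban1983RegularityDecay, (1.22) p.574] -/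
theorem multilevel_le (hk : k ≤ P.K) (C : ChargeData N) (A : VecField P 0) (Λ : Finset (Site P k))
    (Ω : Finset (Site P 0)) (hΩ : ∀ x, x ∈ Ω ↔ blockIter k x ∈ Λ) {δ : ℝ} (hδ : 0 ≤ δ)
    (hreg : ∀ z ∈ Ω, ∀ μ' ν : Fin P.d, |A ⟨z.shift ν, μ'⟩ - A ⟨z, μ'⟩| ≤ δ) (v : ScalarField P 0 N) :
    ∀ i : ℕ, i ≤ k →
      ∑ x ∈ Ω, P.mesh 0 ^ P.d * ‖v x‖ ^ 2
        ≤ (∑ q ∈ Finset.univ.filter (fun q : Site P i => blockIter k (toFinest q) ∈ Λ),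
            P.mesh i ^ P.d * ‖avgQk C A i v q‖ ^ 2)
          + (∑ j ∈ Finset.range i, P.d * ((P.L : ℝ) - 1) * (P.L : ℝ) ^ P.d * P.mesh j ^ 2) *
            (4 * ∑ b : PBond P 0, if Inside Ω b then P.mesh 0 ^ P.d * ‖covDeriv C A v b‖ ^ 2 else 0)
          + (∑ j ∈ Finset.range i, P.d * ((P.L : ℝ) - 1) * (P.L : ℝ) ^ P.d * P.mesh j ^ 2 * ((P.L : ℝ) ^ j) ^ 2) *
            (8 * (P.d : ℝ) ^ 3 * C.e ^ 2 * δ ^ 2 * ∑ x ∈ Ω, P.mesh 0 ^ P.d * ‖v x‖ ^ 2) := by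
  classical
  intro i
  induction i with
  | zero =>
    intro _
    have hΩ0 : Finset.univ.filter (fun q : Site P 0 => blockIter k (toFinest q) ∈ Λ) = Ω := by
      ext x
      rw [Finset.mem_filter, toFinest_zero, hΩ]
      simp
    rw [hΩ0, avgQk_level_zero]
    simp
  | succ i ih =>
    intro hi
    have hi' : i ≤ k := Nat.le_of_succ_le hi
    have h1 := ih hi'
    have h2 := level_step hi hk C A Λ v
    have h3 := energy_level_le hi' hk C A Λ Ω hΩ hδ hreg v
    have hL1 : 0 ≤ (P.L : ℝ) - 1 := by
      have : (1 : ℝ) ≤ P.L := by exact_mod_cast P.hL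
      linarith
    have hκ0 : 0 ≤ (P.d : ℝ) * ((P.L : ℝ) - 1) * (P.L : ℝ) ^ P.d * P.mesh i ^ 2 := by positivity
    have h4 := mul_le_mul_of_nonneg_left h3 hκ0
    rw [Finset.sum_range_succ, Finset.sum_range_succ]
    nlinarith [h1, h2, h4]

/-- **THE MULTILEVEL (COVARIANT) BLOCK POINCARÉ INEQUALITY ON `Bᵏ(Λ)`** (`k ≤ K`; `Λ ⊂ T⁽ᵏ⁾`, `Ω = Bᵏ(Λ) ⊂ T_ε`, any
`v : T_ε → ℝ^N`, `Ã` with `|Ã(⟨z+εe_ν,·⟩) − Ã(⟨z,·⟩)| ≤ δ` on `Ω` — (1.21) of [B4] in lattice units):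
`Σ_{x∈Ω} ε^d|v(x)|² ≤ Σ_{y∈Λ}(Lᵏε)^d|(Q_k(Ã)v)(y)|² + 4dL^d (Lᵏε)² Σ_{b⊂Ω} ε^d|(D^ε_Ã v)(b)|²
+ 8d⁴L^d e² (Lᵏε)²(Lᵏδ)² Σ_{x∈Ω} ε^d|v(x)|²` — the field on the block is controlled by its covariant block average, its
covariant Dirichlet energy times the block size squared, and a holonomy error; the input that turns the mass term
`m²Σ|φ|²` of the (I.2.19) exponent into the printed `−O(1)e²p²(e)Σ_{Ω⁽ᵏ⁾}|φ|²`-type error of (1.22)/(3.29).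
[cite: Balaban1983RegularityDecay, (1.22) p.574; §4 pp.589–591] [cite: Balaban1982Higgs2, (3.29) p.590] -/
theorem block_poincare (hk : k ≤ P.K) (C : ChargeData N) (A : VecField P 0) (Λ : Finset (Site P k))
    (Ω : Finset (Site P 0)) (hΩ : ∀ x, x ∈ Ω ↔ blockIter k x ∈ Λ) {δ : ℝ} (hδ : 0 ≤ δ)
    (hreg : ∀ z ∈ Ω, ∀ μ' ν : Fin P.d, |A ⟨z.shift ν, μ'⟩ - A ⟨z, μ'⟩| ≤ δ) (v : ScalarField P 0 N) :
    ∑ x ∈ Ω, P.mesh 0 ^ P.d * ‖v x‖ ^ 2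
      ≤ (∑ y ∈ Λ, P.mesh k ^ P.d * ‖avgQk C A k v y‖ ^ 2)
        + 4 * P.d * (P.L : ℝ) ^ P.d * P.mesh k ^ 2 *
          (∑ b : PBond P 0, if Inside Ω b then P.mesh 0 ^ P.d * ‖covDeriv C A v b‖ ^ 2 else 0)
        + 8 * (P.d : ℝ) ^ 4 * (P.L : ℝ) ^ P.d * C.e ^ 2 * P.mesh k ^ 2 * ((P.L : ℝ) ^ k) ^ 2 * δ ^ 2 *
          ∑ x ∈ Ω, P.mesh 0 ^ P.d * ‖v x‖ ^ 2 := by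
  classical
  have h := multilevel_le hk C A Λ Ω hΩ hδ hreg v k le_rfl
  have hΛ : Finset.univ.filter (fun q : Site P k => blockIter k (toFinest q) ∈ Λ) = Λ := by
    ext y
    rw [Finset.mem_filter, blockIter_toFinest hk]
    simp
  rw [hΛ] at h
  -- the geometric sums over the levels
  have hL : (1 : ℝ) ≤ P.L := by exact_mod_cast P.hL
  have hL0 : (0 : ℝ) ≤ P.L := by linarith
  have hε : ∀ j : ℕ, P.mesh j ^ 2 = P.mesh 0 ^ 2 * ((P.L : ℝ) ^ 2) ^ j := by
    intro j; rw [mesh_eq j, ← pow_mul, mul_comm 2 j, pow_mul]; ring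
  have hε' : ∀ j : ℕ, P.mesh j ^ 2 * ((P.L : ℝ) ^ j) ^ 2 = P.mesh 0 ^ 2 * ((P.L : ℝ) ^ 4) ^ j := by
    intro j
    rw [hε j, ← pow_mul, ← pow_mul, ← pow_mul, mul_assoc, ← pow_add, show 2 * j + j * 2 = 4 * j by ring]
  have g1 : ((P.L : ℝ) - 1) * ∑ j ∈ Finset.range k, ((P.L : ℝ) ^ 2) ^ j ≤ ((P.L : ℝ) ^ 2) ^ k :=
    geom_level_sum_le (le_self_pow₀ hL (by norm_num)) k
  have g2 : ((P.L : ℝ) - 1) * ∑ j ∈ Finset.range k, ((P.L : ℝ) ^ 4) ^ j ≤ ((P.L : ℝ) ^ 4) ^ k :=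
    geom_level_sum_le (le_self_pow₀ hL (by norm_num)) k
  have e1 : ∑ j ∈ Finset.range k, (P.d : ℝ) * ((P.L : ℝ) - 1) * (P.L : ℝ) ^ P.d * P.mesh j ^ 2
      = (P.d : ℝ) * (P.L : ℝ) ^ P.d * P.mesh 0 ^ 2 * (((P.L : ℝ) - 1) * ∑ j ∈ Finset.range k, ((P.L : ℝ) ^ 2) ^ j) := by
    rw [Finset.mul_sum, Finset.mul_sum]
    refine Finset.sum_congr rfl fun j _ => ?_
    rw [hε j]; ring
  have e2 : ∑ j ∈ Finset.range k, (P.d : ℝ) * ((P.L : ℝ) - 1) * (P.L : ℝ) ^ P.d * P.mesh j ^ 2 * ((P.L : ℝ) ^ j) ^ 2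
      = (P.d : ℝ) * (P.L : ℝ) ^ P.d * P.mesh 0 ^ 2 * (((P.L : ℝ) - 1) * ∑ j ∈ Finset.range k, ((P.L : ℝ) ^ 4) ^ j) := by
    rw [Finset.mul_sum, Finset.mul_sum]
    refine Finset.sum_congr rfl fun j _ => ?_
    rw [mul_assoc ((P.d : ℝ) * ((P.L : ℝ) - 1) * (P.L : ℝ) ^ P.d), hε' j]; ring
  have hk1 : P.mesh k ^ 2 = P.mesh 0 ^ 2 * ((P.L : ℝ) ^ 2) ^ k := hε k
  have hk2 : P.mesh k ^ 2 * ((P.L : ℝ) ^ k) ^ 2 = P.mesh 0 ^ 2 * ((P.L : ℝ) ^ 4) ^ k := hε' k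
  have hc0 : 0 ≤ (P.d : ℝ) * (P.L : ℝ) ^ P.d * P.mesh 0 ^ 2 := by positivity
  have b1 : ∑ j ∈ Finset.range k, (P.d : ℝ) * ((P.L : ℝ) - 1) * (P.L : ℝ) ^ P.d * P.mesh j ^ 2
      ≤ (P.d : ℝ) * (P.L : ℝ) ^ P.d * P.mesh k ^ 2 := by
    rw [e1, hk1]
    calc (P.d : ℝ) * (P.L : ℝ) ^ P.d * P.mesh 0 ^ 2 * (((P.L : ℝ) - 1) * ∑ j ∈ Finset.range k, ((P.L : ℝ) ^ 2) ^ j)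
        ≤ (P.d : ℝ) * (P.L : ℝ) ^ P.d * P.mesh 0 ^ 2 * ((P.L : ℝ) ^ 2) ^ k := mul_le_mul_of_nonneg_left g1 hc0
      _ = (P.d : ℝ) * (P.L : ℝ) ^ P.d * (P.mesh 0 ^ 2 * ((P.L : ℝ) ^ 2) ^ k) := by ring
  have b2 : ∑ j ∈ Finset.range k, (P.d : ℝ) * ((P.L : ℝ) - 1) * (P.L : ℝ) ^ P.d * P.mesh j ^ 2 * ((P.L : ℝ) ^ j) ^ 2
      ≤ (P.d : ℝ) * (P.L : ℝ) ^ P.d * (P.mesh k ^ 2 * ((P.L : ℝ) ^ k) ^ 2) := by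
    rw [e2, hk2]
    calc (P.d : ℝ) * (P.L : ℝ) ^ P.d * P.mesh 0 ^ 2 * (((P.L : ℝ) - 1) * ∑ j ∈ Finset.range k, ((P.L : ℝ) ^ 4) ^ j)
        ≤ (P.d : ℝ) * (P.L : ℝ) ^ P.d * P.mesh 0 ^ 2 * ((P.L : ℝ) ^ 4) ^ k := mul_le_mul_of_nonneg_left g2 hc0
      _ = (P.d : ℝ) * (P.L : ℝ) ^ P.d * (P.mesh 0 ^ 2 * ((P.L : ℝ) ^ 4) ^ k) := by ring
  have hT2 : 0 ≤ 4 * ∑ b : PBond P 0, (if Inside Ω b then P.mesh 0 ^ P.d * ‖covDeriv C A v b‖ ^ 2 else 0) :=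
    mul_nonneg (by norm_num) (Finset.sum_nonneg fun b _ => by
      split_ifs
      · exact mul_nonneg (pow_nonneg (P.mesh_pos 0).le _) (sq_nonneg _)
      · exact le_rfl)
  have hT3 : 0 ≤ 8 * (P.d : ℝ) ^ 3 * C.e ^ 2 * δ ^ 2 * ∑ x ∈ Ω, P.mesh 0 ^ P.d * ‖v x‖ ^ 2 := by
    have : 0 ≤ ∑ x ∈ Ω, P.mesh 0 ^ P.d * ‖v x‖ ^ 2 :=
      Finset.sum_nonneg fun x _ => mul_nonneg (pow_nonneg (P.mesh_pos 0).le _) (sq_nonneg _)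
    positivity
  have c1 := mul_le_mul_of_nonneg_right b1 hT2
  have c2 := mul_le_mul_of_nonneg_right b2 hT3
  nlinarith [h, c1, c2]

end Levels

end Literature.MathematicalPhysics.QuantumFieldTheory.Balaban1983to89.B2Ineq329BlockPoincare
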